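import Literature.NumberTheory.Transcendental.SixExponentialsSeveralVariablesThm11Proofs
import Literature.NumberTheory.Transcendental.SixExponentialsSeveralVariablesProp61Proofs
import HarnessLib

/-!
# Waldschmidt 1981: Théorèmes 1.1 and 2.1 from Corollaire 4.2 (the chain §4 → §6 assembled)

Topic `Literature/NumberTheory/Transcendental`; sibling proof file of
`SixExponentialsSeveralVariables.lean` (the named facts `Waldschmidt1981.thm_1_1`, `thm_2_1` of
[Waldschmidt1981]). The tree now proves every deduction the source prints between its
transcendence input and its main theorems:

* §6 c) (p. 111): `thm_2_1_of_thm_1_1` (`SixExponentialsSeveralVariablesProofs.lean`);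
* §6 a) (pp. 109–110): `thm_1_1_of_prop_6_1` (`SixExponentialsSeveralVariablesThm11Proofs.lean`);
* §6 a) (p. 109) with §5 (Lemmes 5.1–5.4, pp. 106–109): `prop_6_1_of_cor_4_2`
  (`SixExponentialsSeveralVariablesProp61Proofs.lean`), `lem_5_1_holds`
  (`SixExponentialsSeveralVariablesStepsProofs.lean`);
* §3 (pp. 100–102): `cor_3_2_holds` (`SixExponentialsSeveralVariablesAuxiliary.lean`).

This file records the composites

`thm_1_1_of_cor_4_2 : cor_4_2 → thm_1_1`, `thm_2_1_of_cor_4_2 : cor_4_2 → thm_2_1`,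

so that the un-discharged input below the several-variable six exponentials theorem
(Théorème 1.1), its matrix form (Théorème 2.1) and Roy's quotation of the latter
(`Literature.Barriers.Schanuel.waldschmidt1981_linearSubgroup_matrix`, via
`LinearSubgroupMethodLimitWaldschmidtProofs.lean`) is exactly **Corollaire 4.2**
(`Waldschmidt1981.cor_4_2`, p. 105: "si les `exp⟨xᵢ, yⱼ⟩` sont tous algébriques et si `d > n`,
alors `χ(Y, X) ≤ n/(d − n)`"), which the source derives (p. 105) from Corollaire 3.2 (proved in
the tree), **Théorème 4.1 = Masser's zero estimate** ([Masser1981, Theorem 2], the tree's named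
fact `Waldschmidt1981.thm_4_1`, not discharged) and Liouville's inequality. The discharges
`thm_1_1_holds := thm_1_1_of_cor_4_2 cor_4_2_holds`,
`thm_2_1_holds := thm_2_1_of_cor_4_2 cor_4_2_holds` are then one-liners.

## References

* [Waldschmidt1981] M. Waldschmidt, *Transcendance et exponentielles en plusieurs variables*,
  Invent. Math. 63 (1981) 97–127, doi:10.1007/bf01389195: §4 Corollaire 4.2 (p. 105), §6 a), c)
  (pp. 109–111).
* [Masser1981] D. W. Masser, *On polynomials and exponential polynomials in several complex
  variables*, Invent. Math. 63 (1981) 81–95, Theorem 2.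
-/

noncomputable section

namespace Literature.NumberTheory.Transcendental.Waldschmidt1981

/-- **Théorème 1.1 from Corollaire 4.2**: Proposition 6.1 from Corollaire 4.2 (§5 and §6 a),
`prop_6_1_of_cor_4_2`), then Théorème 1.1 from Proposition 6.1 (§6 a), `thm_1_1_of_prop_6_1`).
[cite: Waldschmidt1981, §6 a) (pp. 109–110)] -/
theorem thm_1_1_of_cor_4_2 (h42 : cor_4_2) : thm_1_1 :=
  thm_1_1_of_prop_6_1 (prop_6_1_of_cor_4_2 h42)

/-- **Théorème 2.1 from Corollaire 4.2**: the composite with §6 c) (`thm_2_1_of_thm_1_1`).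
[cite: Waldschmidt1981, §6 a), c) (pp. 109–111)] -/
theorem thm_2_1_of_cor_4_2 (h42 : cor_4_2) : thm_2_1 :=
  thm_2_1_of_thm_1_1 (thm_1_1_of_cor_4_2 h42)

end Literature.NumberTheory.Transcendental.Waldschmidt1981

end
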